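import Summits.Ventures.YMGap.Census.TwistCensusSheets
import Summits.Ventures.YMGap.Census.MarkedPlaquetteTransport
import Literature.MathematicalPhysics.QuantumFieldTheory.VortexTwistPlaneSymmetry
import HarnessLib

/-!
# Venture YMGap, track (b) census — relabelling the AXES of a rectangular torus: the census objects of
# `L₀ × ⋯ × L_{d−1}` and of the torus with two sides exchanged are the same (transport of `I(S)`, `Z`, `Z⁻_V`, `N_V`)

HONEST FRAMING: venture file of the cell `pub-ymgap` (QuantumFields programme), track (b) (exact small-volume census,
one-character truncation).  Pure bookkeeping about finite Haar integrals on finite rectangular tori: nothing about signs,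
root locations, limits, the Wilson action, confinement or a mass gap; no number from a table; no conjecture is imported.

WHY.  The tree's reflection-positivity SIGN RULE for the census conjecture C-1 (`Census/RectReflectionGeometry` →
`RectReflectionMeasure` → `RectReflectionPositivity` → `TwistCensusTopMomentRectRP`) reflects across the FIRST axis: it
needs `Ls 0` even and treats the planes `(0, j)`.  On the cubic torus `(ℤ/L)^d` a transposition of two axes is a symmetry of
one and the same type (`Tomboulis2007.plaqTranspose`, `VortexTwistPlaneSymmetry`); on a rectangular torus it changes the side
vector, `RectTorusSite Ls → RectTorusSite (Ls ∘ τ)`, i.e. the TYPE — the dependent-type transport written here.  With it, every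
plane through ANY even side of a 3-torus is a plane `(0, j')` of a torus with even first side, and the sign rule applies there
(`Census/TwistCensusTopMomentRectRPAxis.lean`).

CONTENTS (`τ = Equiv.swap μ ν`, `RectTranspose.sides Ls μ ν = Ls ∘ τ`):
* §1 (generic) `oneCharZtwPoly_map_equiv`, `oneCharZPoly_eq_of_equiv`, `twistCensusPoly_map_equiv`: a bijection of the
  plaquettes of two rectangular tori that preserves every Haar moment `I(S)` carries `Z`, `Z⁻_V`, `N_V` (as polynomials in
  `s`) to `Z`, `Z⁻_{e(V)}`, `N_{e(V)}`;
* §2 the transposition equivalences `RectTranspose.siteEquiv` (`x ↦ x ∘ τ`, Mathlib `Equiv.piCongrLeft'`), `linkEquiv`,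
  `configEquiv` (Mathlib `MeasurableEquiv.arrowCongr'`, Haar-measure preserving: `measurePreserving_configEquiv`), `dirEquiv`
  (the tree's `Tomboulis2007.dirTranspose`, re-sorting the two directions), `plaqEquiv`;
* §3 `rectPlaquetteHolonomy_configEquiv` (`U^τ_{τx, kl} = U_{x, τk τl}`), `rectPlaqChar_configEquiv` (the `SU(2)` character is
  inversion invariant, so the re-sorting of the directions is immaterial), `rectCharMoment_map_plaqEquiv`
  (**`I_{Ls∘τ}(τS) = I_{Ls}(S)`**), `map_plaqEquiv_rectVortexSheet` (**`τ𝒱_{ij} = 𝒱_{τ(ij)}`**), `map_plaqEquiv_flatSheet`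
  (`τΠ_{ij}(y) = Π_{τ(ij)}(y∘τ)`, lit-2's flat sheets), `rectCharMoment_compl_flatSheet_transpose` (`I(Λ₂ ∖ Π)` transported), and the
  transport of the census polynomial of a plane: **`twistCensusPoly_rectVortexSheet_transpose`** (`N_{τ(ij)}(Ls ∘ τ) = N_{ij}(Ls)`),
  `card_rectPlaquette_sides`, `rectCharMoment_univ_sides`.

References: E. T. Tomboulis, arXiv:0707.2179 §4 (text before eq. (4.3): the twisted plane is immaterial)
[cite: Tomboulis2007Confinement, §4 (text before eq. (4.3))]; K. Osterwalder, E. Seiler, Ann. Phys. 110 (1978) 440, §2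
(lattice symmetries) [cite: OsterwalderSeilerAnnPhys1978, §2]; HOME/STRUCTURE.md §4 N-3 (ii).
-/

noncomputable section

open MeasureTheory Finset Real Polynomial
open scoped BigOperators
open Literature.MathematicalPhysics.QuantumLattice
open Literature.MathematicalPhysics.QuantumFieldTheory
open Literature.MathematicalPhysics.QuantumFieldTheory.Tomboulis2007

namespace Summit.Ventures.YMGap.Census

variable {d : ℕ}

/-! ### §1 Moment-preserving plaquette bijections carry `Z`, `Z⁻_V`, `N_V` along -/

section MomentBijection

variable {d' : ℕ} (Ls : Fin d → ℕ) [∀ i, NeZero (Ls i)] (Ls' : Fin d' → ℕ) [∀ i, NeZero (Ls' i)]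
  (e : RectPlaquette Ls ≃ RectPlaquette Ls')

/-- **A plaquette bijection preserving every Haar moment carries `Z⁻_V` to `Z⁻_{e(V)}`** (as polynomials in `s`):
reindex the character expansion `Σ_S 2^{|S|} (−1)^{|S ∩ V|} I(S) X^{|S|}` by `S ↦ e(S)`. -/
theorem oneCharZtwPoly_map_equiv (he : ∀ S : Finset (RectPlaquette Ls), rectCharMoment Ls' (S.map e.toEmbedding) = rectCharMoment Ls S)
    (V : Finset (RectPlaquette Ls)) :
    oneCharZtwPoly Ls' (V.map e.toEmbedding) = oneCharZtwPoly Ls V := by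
  unfold oneCharZtwPoly
  symm
  refine Finset.sum_equiv e.finsetCongr (fun S => ?_) (fun S _ => ?_)
  · simp only [Finset.mem_powerset, Finset.subset_univ]
  · rw [Equiv.finsetCongr_apply, Finset.card_map, ← Finset.map_inter, Finset.card_map, he]

/-- **… carries `Z` to `Z`.** -/
theorem oneCharZPoly_eq_of_equiv (he : ∀ S : Finset (RectPlaquette Ls), rectCharMoment Ls' (S.map e.toEmbedding) = rectCharMoment Ls S) :
    oneCharZPoly Ls' = oneCharZPoly Ls := by
  unfold oneCharZPoly
  symm
  refine Finset.sum_equiv e.finsetCongr (fun S => ?_) (fun S _ => ?_)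
  · simp only [Finset.mem_powerset, Finset.subset_univ]
  · rw [Equiv.finsetCongr_apply, Finset.card_map, he]

/-- **… and carries the census polynomial `N_V` to `N_{e(V)}`.** -/
theorem twistCensusPoly_map_equiv (he : ∀ S : Finset (RectPlaquette Ls), rectCharMoment Ls' (S.map e.toEmbedding) = rectCharMoment Ls S)
    (V : Finset (RectPlaquette Ls)) :
    twistCensusPoly Ls' (V.map e.toEmbedding) = twistCensusPoly Ls V := by
  unfold twistCensusPoly
  rw [oneCharZtwPoly_map_equiv Ls Ls' e he, oneCharZPoly_eq_of_equiv Ls Ls' e he]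

omit [∀ i, NeZero (Ls i)] [∀ i, NeZero (Ls' i)] in
/-- A bijection maps `S` onto `T` as soon as it carries membership in `S` to membership in `T` (plumbing). -/
theorem map_equiv_eq_of_forall_mem_iff {S : Finset (RectPlaquette Ls)} {T : Finset (RectPlaquette Ls')}
    (h : ∀ p, p ∈ S ↔ e p ∈ T) : S.map e.toEmbedding = T := by
  ext q
  rw [Finset.mem_map_equiv]
  have hq := h (e.symm q)
  rw [Equiv.apply_symm_apply] at hq
  exact hq

end MomentBijection

/-- Membership in the twist stack `𝒱_{ij}`: an `(i, j)`-plaquette based at `x_i = x_j = 0`. -/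
theorem mem_rectVortexSheet (Ls : Fin d → ℕ) [∀ i, NeZero (Ls i)] {i j : Fin d} (hij : i < j) (p : RectPlaquette Ls) :
    p ∈ rectVortexSheet Ls i j hij ↔ p.2 = ⟨(i, j), hij⟩ ∧ p.1 i = 0 ∧ p.1 j = 0 := by
  unfold rectVortexSheet
  simp only [Finset.mem_filter, Finset.mem_univ, true_and]

/-! ### §2 The transposition `τ = (μ ν)` of two axes: sides, sites, links, configurations, directions, plaquettes -/

namespace RectTranspose

variable (Ls : Fin d → ℕ) (μ ν : Fin d)

/-- The transposed side vector `Ls ∘ τ`: side `k` of the new torus is side `τ k` of the old one (an `abbrev`: the instances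
`NeZero (Ls (τ k))` are found through it, and `ZMod (sides Ls μ ν k)` is reducibly `ZMod (Ls (τ k))`). -/
abbrev sides : Fin d → ℕ := fun k => Ls (Equiv.swap μ ν k)

/-- `sides` at `k` is `Ls (τ k)`. -/
theorem sides_apply (k : Fin d) : sides Ls μ ν k = Ls (Equiv.swap μ ν k) := rfl

/-- **Sites**: `x ↦ x ∘ τ`, `RectTorusSite Ls ≃ RectTorusSite (Ls ∘ τ)` (Mathlib's dependent transport `Equiv.piCongrLeft'`;
`τ⁻¹ = τ`). -/
def siteEquiv : RectTorusSite Ls ≃ RectTorusSite (sides Ls μ ν) :=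
  Equiv.piCongrLeft' (fun i => ZMod (Ls i)) (Equiv.swap μ ν)

/-- Coordinate `k` of the transposed site is coordinate `τ k`. -/
@[simp] theorem siteEquiv_apply (x : RectTorusSite Ls) (k : Fin d) : siteEquiv Ls μ ν x k = x (Equiv.swap μ ν k) := rfl

/-- The site transport is additive. -/
theorem siteEquiv_add (x y : RectTorusSite Ls) : siteEquiv Ls μ ν (x + y) = siteEquiv Ls μ ν x + siteEquiv Ls μ ν y := rfl

/-- The site transport carries the unit vector `e_{τ k}` to `e_k`. -/
@[simp] theorem siteEquiv_single [∀ i, NeZero (Ls i)] (k : Fin d) :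
    siteEquiv Ls μ ν (Pi.single (Equiv.swap μ ν k) 1) = Pi.single k 1 := by
  funext k'
  rw [siteEquiv_apply]
  by_cases hk : k' = k
  · subst hk
    rw [Pi.single_eq_same, Pi.single_eq_same]
  · rw [Pi.single_eq_of_ne hk, Pi.single_eq_of_ne (fun h => hk ((Equiv.swap μ ν).injective h))]

/-- **Links**: `(x, i) ↦ (x ∘ τ, τ i)`. -/
def linkEquiv : RectEdge Ls ≃ RectEdge (sides Ls μ ν) := (siteEquiv Ls μ ν).prodCongr (Equiv.swap μ ν)

/-- The link transport on a pair. -/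
@[simp] theorem linkEquiv_apply (x : RectTorusSite Ls) (i : Fin d) :
    linkEquiv Ls μ ν (x, i) = (siteEquiv Ls μ ν x, Equiv.swap μ ν i) := rfl

section Config

variable (G : Type*) [MeasurableSpace G]

/-- **Configurations**: `U ↦ U ∘ (linkEquiv)⁻¹`, a measurable equivalence (Mathlib `MeasurableEquiv.arrowCongr'`). -/
def configEquiv : RectGaugeConfig Ls G ≃ᵐ RectGaugeConfig (sides Ls μ ν) G :=
  MeasurableEquiv.arrowCongr' (linkEquiv Ls μ ν) (MeasurableEquiv.refl G)

/-- The transported configuration evaluates through the inverse link transport. -/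
theorem configEquiv_apply (U : RectGaugeConfig Ls G) (l : RectEdge (sides Ls μ ν)) :
    configEquiv Ls μ ν G U l = U ((linkEquiv Ls μ ν).symm l) := rfl

/-- The transported configuration on a transported link is the original link variable. -/
@[simp] theorem configEquiv_apply_linkEquiv (U : RectGaugeConfig Ls G) (l : RectEdge Ls) :
    configEquiv Ls μ ν G U (linkEquiv Ls μ ν l) = U l := by
  rw [configEquiv_apply, Equiv.symm_apply_apply]

/-- The transported configuration on the link `(x ∘ τ, m)` is `U (x, τ m)`. -/
theorem configEquiv_apply_siteEquiv (U : RectGaugeConfig Ls G) (x : RectTorusSite Ls) (m : Fin d) :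
    configEquiv Ls μ ν G U (siteEquiv Ls μ ν x, m) = U (x, Equiv.swap μ ν m) := by
  have h : (siteEquiv Ls μ ν x, m) = linkEquiv Ls μ ν (x, Equiv.swap μ ν m) := by
    rw [linkEquiv_apply, Equiv.swap_apply_self]
  rw [h, configEquiv_apply_linkEquiv]

end Config

/-- **The configuration transport preserves the product Haar measure** (it only relabels the factors). -/
theorem measurePreserving_configEquiv [∀ i, NeZero (Ls i)] :
    MeasurePreserving (configEquiv Ls μ ν SU2) (Measure.pi fun _ : RectEdge Ls => haarProbability SU2)
      (Measure.pi fun _ : RectEdge (sides Ls μ ν) => haarProbability SU2) :=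
  measurePreserving_arrowCongr' (fun _ : RectEdge Ls => haarProbability SU2)
    (fun _ : RectEdge (sides Ls μ ν) => haarProbability SU2) (linkEquiv Ls μ ν) (MeasurableEquiv.refl SU2)
    fun _ => MeasurePreserving.id _

/-- `dirTranspose μ ν` (the tree's re-sorted transposition of a direction pair) is an involution (plumbing; the tree's
proof in `VortexTwistPlaneSymmetry` is private). -/
theorem dirTranspose_dirTranspose' (q : {p : Fin d × Fin d // p.1 < p.2}) :
    dirTranspose μ ν (dirTranspose μ ν q) = q := by
  obtain ⟨⟨a, b⟩, hab⟩ := q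
  have hab' : a < b := hab
  by_cases h1 : Equiv.swap μ ν a < Equiv.swap μ ν b
  · have e1 : dirTranspose μ ν ⟨(a, b), hab⟩ = ⟨(Equiv.swap μ ν a, Equiv.swap μ ν b), h1⟩ := by
      unfold dirTranspose; rw [dif_pos h1]
    rw [e1]
    unfold dirTranspose
    simp only [Equiv.swap_apply_self]
    rw [dif_pos hab']
  · have e1 : dirTranspose μ ν ⟨(a, b), hab⟩ = ⟨(Equiv.swap μ ν b, Equiv.swap μ ν a),
        lt_of_le_of_ne (not_lt.1 h1) fun e => hab'.ne ((Equiv.swap μ ν).injective e).symm⟩ := by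
      unfold dirTranspose; rw [dif_neg h1]
    rw [e1]
    unfold dirTranspose
    simp only [Equiv.swap_apply_self]
    rw [dif_neg (lt_asymm hab')]

/-- **Directions**: `dirTranspose μ ν` as a permutation of the ordered direction pairs. -/
def dirEquiv : Equiv.Perm {p : Fin d × Fin d // p.1 < p.2} :=
  Function.Involutive.toPerm (dirTranspose μ ν) (dirTranspose_dirTranspose' μ ν)

/-- `dirEquiv` acts as `dirTranspose`. -/
@[simp] theorem dirEquiv_apply (q : {p : Fin d × Fin d // p.1 < p.2}) : dirEquiv μ ν q = dirTranspose μ ν q := rfl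

/-- **Plaquettes**: transpose the base point, exchange and re-sort the two directions. -/
def plaqEquiv : RectPlaquette Ls ≃ RectPlaquette (sides Ls μ ν) := (siteEquiv Ls μ ν).prodCongr (dirEquiv μ ν)

/-- The plaquette transport on a pair. -/
@[simp] theorem plaqEquiv_apply (x : RectTorusSite Ls) (q : {p : Fin d × Fin d // p.1 < p.2}) :
    plaqEquiv Ls μ ν (x, q) = (siteEquiv Ls μ ν x, dirTranspose μ ν q) := rfl

/-! ### §3 Holonomies, characters, Haar moments, twist stacks and census polynomials under the transposition -/

/-- **Holonomies**: the `(k, l)`-holonomy of the transported configuration at `x ∘ τ` is the `(τk, τl)`-holonomy of `U`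
at `x` (the cubic `plaquetteHolonomy_configTranspose`). -/
theorem rectPlaquetteHolonomy_configEquiv [∀ i, NeZero (Ls i)] {G : Type*} [Group G] [MeasurableSpace G]
    (U : RectGaugeConfig Ls G) (x : RectTorusSite Ls) (k l : Fin d) :
    rectPlaquetteHolonomy (configEquiv Ls μ ν G U) (siteEquiv Ls μ ν x) k l =
      rectPlaquetteHolonomy U x (Equiv.swap μ ν k) (Equiv.swap μ ν l) := by
  have h2 : ∀ m : Fin d, siteEquiv Ls μ ν x + Pi.single m 1 = siteEquiv Ls μ ν (x + Pi.single (Equiv.swap μ ν m) 1) := by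
    intro m
    rw [siteEquiv_add, siteEquiv_single]
  unfold rectPlaquetteHolonomy
  rw [h2 k, h2 l, configEquiv_apply_siteEquiv, configEquiv_apply_siteEquiv, configEquiv_apply_siteEquiv,
    configEquiv_apply_siteEquiv]

/-- Reversing the orientation of a plaquette inverts its holonomy (plumbing). -/
theorem rectPlaquetteHolonomy_rev {G : Type*} [Group G] (U : RectGaugeConfig Ls G) (x : RectTorusSite Ls) (i j : Fin d) :
    rectPlaquetteHolonomy U x j i = (rectPlaquetteHolonomy U x i j)⁻¹ := by
  simp only [rectPlaquetteHolonomy, mul_inv_rev, inv_inv, mul_assoc]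

/-- **Characters**: `χ_½` of the transported configuration on the transported plaquette equals `χ_½(U_p)` (the
re-sorting of the two directions at most inverts the holonomy, and `χ_½(W⁻¹) = χ_½(W)`, the tree's `su2Char_inv'`). -/
theorem rectPlaqChar_configEquiv [∀ i, NeZero (Ls i)] (U : RectGaugeConfig Ls SU2) (p : RectPlaquette Ls) :
    rectPlaqChar (configEquiv Ls μ ν SU2 U) (plaqEquiv Ls μ ν p) = rectPlaqChar U p := by
  obtain ⟨x, ⟨⟨i, j⟩, hij⟩⟩ := p
  have hij' : i < j := hij
  rw [plaqEquiv_apply]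
  unfold rectPlaqChar
  by_cases h : Equiv.swap μ ν i < Equiv.swap μ ν j
  · have e1 : dirTranspose μ ν ⟨(i, j), hij⟩ = ⟨(Equiv.swap μ ν i, Equiv.swap μ ν j), h⟩ := by
      unfold dirTranspose; rw [dif_pos h]
    rw [e1]
    dsimp only
    rw [rectPlaquetteHolonomy_configEquiv, Equiv.swap_apply_self, Equiv.swap_apply_self]
  · have e1 : dirTranspose μ ν ⟨(i, j), hij⟩ = ⟨(Equiv.swap μ ν j, Equiv.swap μ ν i),
        lt_of_le_of_ne (not_lt.1 h) fun e => hij'.ne ((Equiv.swap μ ν).injective e).symm⟩ := by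
      unfold dirTranspose; rw [dif_neg h]
    rw [e1]
    dsimp only
    rw [rectPlaquetteHolonomy_configEquiv, Equiv.swap_apply_self, Equiv.swap_apply_self, rectPlaquetteHolonomy_rev,
      su2Char_inv']

/-- **Haar moments are transported**: `I_{Ls∘τ}(τS) = I_{Ls}(S)` for every plaquette set `S` (change of variables
`U ↦ U ∘ τ`, which preserves the product Haar measure). [cite: Tomboulis2007Confinement, §4 (text before eq. (4.3))] -/
theorem rectCharMoment_map_plaqEquiv [∀ i, NeZero (Ls i)] (S : Finset (RectPlaquette Ls)) :
    rectCharMoment (sides Ls μ ν) (S.map (plaqEquiv Ls μ ν).toEmbedding) = rectCharMoment Ls S := by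
  unfold rectCharMoment
  simp_rw [Finset.prod_map, Equiv.coe_toEmbedding]
  rw [← (measurePreserving_configEquiv Ls μ ν).integral_comp'
    (fun U' : RectGaugeConfig (sides Ls μ ν) SU2 => ∏ p ∈ S, rectPlaqChar U' (plaqEquiv Ls μ ν p))]
  refine integral_congr_ae (ae_of_all _ fun U => ?_)
  exact Finset.prod_congr rfl fun p _ => rectPlaqChar_configEquiv Ls μ ν U p

/-- `|Λ₂(Ls ∘ τ)| = |Λ₂(Ls)|`. -/
theorem card_rectPlaquette_sides [∀ i, NeZero (Ls i)] :
    Fintype.card (RectPlaquette (sides Ls μ ν)) = Fintype.card (RectPlaquette Ls) :=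
  (Fintype.card_congr (plaqEquiv Ls μ ν)).symm

/-- `I_{Ls∘τ}(Λ₂) = I_{Ls}(Λ₂)`. -/
theorem rectCharMoment_univ_sides [∀ i, NeZero (Ls i)] :
    rectCharMoment (sides Ls μ ν) univ = rectCharMoment Ls univ := by
  rw [← Finset.map_univ_equiv (plaqEquiv Ls μ ν), rectCharMoment_map_plaqEquiv]

/-- **The census polynomial is transported**: `N_{τV}(Ls ∘ τ) = N_V(Ls)` for every twist set `V`. -/
theorem twistCensusPoly_map_plaqEquiv [∀ i, NeZero (Ls i)] (V : Finset (RectPlaquette Ls)) :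
    twistCensusPoly (sides Ls μ ν) (V.map (plaqEquiv Ls μ ν).toEmbedding) = twistCensusPoly Ls V :=
  twistCensusPoly_map_equiv Ls (sides Ls μ ν) (plaqEquiv Ls μ ν) (rectCharMoment_map_plaqEquiv Ls μ ν) V

/-- `Z(Ls ∘ τ) = Z(Ls)` as polynomials in `s`. -/
theorem oneCharZPoly_sides [∀ i, NeZero (Ls i)] : oneCharZPoly (sides Ls μ ν) = oneCharZPoly Ls :=
  oneCharZPoly_eq_of_equiv Ls (sides Ls μ ν) (plaqEquiv Ls μ ν) (rectCharMoment_map_plaqEquiv Ls μ ν)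

/-- **Twist stacks are transported**: `τ(𝒱_{ij}) = 𝒱_{i'j'}` where `(i', j')` is the re-sorted pair `(τ i, τ j)`
(`dirTranspose μ ν (i, j) = (i', j')`). -/
theorem map_plaqEquiv_rectVortexSheet [∀ i, NeZero (Ls i)] {i j : Fin d} (hij : i < j) {i' j' : Fin d} (h' : i' < j')
    (hT : dirTranspose μ ν ⟨(i, j), hij⟩ = ⟨(i', j'), h'⟩) :
    (rectVortexSheet Ls i j hij).map (plaqEquiv Ls μ ν).toEmbedding = rectVortexSheet (sides Ls μ ν) i' j' h' := by
  have hinv : Function.Involutive (dirTranspose μ ν) := dirTranspose_dirTranspose' μ ν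
  refine map_equiv_eq_of_forall_mem_iff Ls (sides Ls μ ν) (plaqEquiv Ls μ ν) fun p => ?_
  obtain ⟨x, q⟩ := p
  rw [mem_rectVortexSheet, mem_rectVortexSheet, plaqEquiv_apply]
  dsimp only
  rw [← hT, hinv.injective.eq_iff, siteEquiv_apply, siteEquiv_apply]
  -- `x (τ (τ k)) = 0 ↔ x k = 0` without rewriting inside a dependent type
  have hx : ∀ k k' : Fin d, k' = k → (x k' = 0 ↔ x k = 0) := by
    rintro k _ rfl
    exact Iff.rfl
  by_cases h : Equiv.swap μ ν i < Equiv.swap μ ν j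
  · have e1 : dirTranspose μ ν ⟨(i, j), hij⟩ = ⟨(Equiv.swap μ ν i, Equiv.swap μ ν j), h⟩ := by
      unfold dirTranspose; rw [dif_pos h]
    have hi : i' = Equiv.swap μ ν i := by rw [e1] at hT; exact (congrArg (fun t => t.1.1) hT).symm
    have hj : j' = Equiv.swap μ ν j := by rw [e1] at hT; exact (congrArg (fun t => t.1.2) hT).symm
    subst hi hj
    rw [hx _ _ (Equiv.swap_apply_self μ ν i), hx _ _ (Equiv.swap_apply_self μ ν j)]
  · have e1 : dirTranspose μ ν ⟨(i, j), hij⟩ = ⟨(Equiv.swap μ ν j, Equiv.swap μ ν i),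
        lt_of_le_of_ne (not_lt.1 h) fun e => (show i < j from hij).ne ((Equiv.swap μ ν).injective e).symm⟩ := by
      unfold dirTranspose; rw [dif_neg h]
    have hi : i' = Equiv.swap μ ν j := by rw [e1] at hT; exact (congrArg (fun t => t.1.1) hT).symm
    have hj : j' = Equiv.swap μ ν i := by rw [e1] at hT; exact (congrArg (fun t => t.1.2) hT).symm
    subst hi hj
    rw [hx _ _ (Equiv.swap_apply_self μ ν j), hx _ _ (Equiv.swap_apply_self μ ν i)]
    exact ⟨fun ⟨hq, h1, h2⟩ => ⟨hq, h2, h1⟩, fun ⟨hq, h1, h2⟩ => ⟨hq, h2, h1⟩⟩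

/-- **Flat sheets are transported**: `τ(Π_{ij}(y)) = Π_{i'j'}(y ∘ τ)` — the flat `(i, j)`-sheet through `y` goes to the flat
`(i', j')`-sheet through `y ∘ τ`, `(i', j')` the re-sorted pair `(τ i, τ j)`. -/
theorem map_plaqEquiv_flatSheet [∀ i, NeZero (Ls i)] {i j : Fin d} (hij : i < j) {i' j' : Fin d} (h' : i' < j')
    (hT : dirTranspose μ ν ⟨(i, j), hij⟩ = ⟨(i', j'), h'⟩) (y : RectTorusSite Ls) :
    (flatSheet Ls hij y).map (plaqEquiv Ls μ ν).toEmbedding = flatSheet (sides Ls μ ν) h' (siteEquiv Ls μ ν y) := by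
  have hinv : Function.Involutive (dirTranspose μ ν) := dirTranspose_dirTranspose' μ ν
  -- the pair `{i', j'}` is `{τ i, τ j}`: `k ∉ {i', j'} ↔ τ k ∉ {i, j}`
  have hset : ∀ k : Fin d, (k ≠ i' ∧ k ≠ j') ↔ (Equiv.swap μ ν k ≠ i ∧ Equiv.swap μ ν k ≠ j) := by
    intro k
    by_cases h : Equiv.swap μ ν i < Equiv.swap μ ν j
    · have e1 : dirTranspose μ ν ⟨(i, j), hij⟩ = ⟨(Equiv.swap μ ν i, Equiv.swap μ ν j), h⟩ := by
        unfold dirTranspose; rw [dif_pos h]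
      have hi : i' = Equiv.swap μ ν i := by rw [e1] at hT; exact (congrArg (fun t => t.1.1) hT).symm
      have hj : j' = Equiv.swap μ ν j := by rw [e1] at hT; exact (congrArg (fun t => t.1.2) hT).symm
      subst hi hj
      rw [ne_eq, ne_eq, ne_eq, ne_eq, ← Equiv.swap_apply_eq_iff, ← Equiv.swap_apply_eq_iff]
    · have e1 : dirTranspose μ ν ⟨(i, j), hij⟩ = ⟨(Equiv.swap μ ν j, Equiv.swap μ ν i),
          lt_of_le_of_ne (not_lt.1 h) fun e => (show i < j from hij).ne ((Equiv.swap μ ν).injective e).symm⟩ := by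
        unfold dirTranspose; rw [dif_neg h]
      have hi : i' = Equiv.swap μ ν j := by rw [e1] at hT; exact (congrArg (fun t => t.1.1) hT).symm
      have hj : j' = Equiv.swap μ ν i := by rw [e1] at hT; exact (congrArg (fun t => t.1.2) hT).symm
      subst hi hj
      rw [ne_eq, ne_eq, ne_eq, ne_eq, ← Equiv.swap_apply_eq_iff, ← Equiv.swap_apply_eq_iff]
      exact and_comm
  -- `x (τ (τ k)) = y (τ (τ k)) ↔ x k = y k` without rewriting inside a dependent type
  have hxy : ∀ (x : RectTorusSite Ls) (k k' : Fin d), k' = k → (x k' = y k' ↔ x k = y k) := by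
    rintro x k _ rfl
    exact Iff.rfl
  refine map_equiv_eq_of_forall_mem_iff Ls (sides Ls μ ν) (plaqEquiv Ls μ ν) fun p => ?_
  obtain ⟨x, q⟩ := p
  rw [mem_flatSheet, mem_flatSheet, plaqEquiv_apply]
  dsimp only
  rw [← hT, hinv.injective.eq_iff]
  refine and_congr_right fun _ => ?_
  simp only [siteEquiv_apply]
  constructor
  · intro H k hki hkj
    obtain ⟨h1, h2⟩ := (hset k).1 ⟨hki, hkj⟩
    exact H _ h1 h2
  · intro H k hki hkj
    have hk : Equiv.swap μ ν (Equiv.swap μ ν k) ≠ i ∧ Equiv.swap μ ν (Equiv.swap μ ν k) ≠ j := by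
      rw [Equiv.swap_apply_self]; exact ⟨hki, hkj⟩
    obtain ⟨h1, h2⟩ := (hset (Equiv.swap μ ν k)).2 hk
    exact (hxy x k _ (Equiv.swap_apply_self μ ν k)).1 (H _ h1 h2)

/-- **`I(Λ₂ ∖ Π)` is transported**: the cosheet moment of the flat `(i', j')`-sheet through `y ∘ τ` on `Ls ∘ τ` is the cosheet
moment of the flat `(i, j)`-sheet through `y` on `Ls`. -/
theorem rectCharMoment_compl_flatSheet_transpose [∀ i, NeZero (Ls i)] {i j : Fin d} (hij : i < j) {i' j' : Fin d}
    (h' : i' < j') (hT : dirTranspose μ ν ⟨(i, j), hij⟩ = ⟨(i', j'), h'⟩) (y : RectTorusSite Ls) :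
    rectCharMoment (sides Ls μ ν) (univ \ flatSheet (sides Ls μ ν) h' (siteEquiv Ls μ ν y)) =
      rectCharMoment Ls (univ \ flatSheet Ls hij y) := by
  rw [← rectCharMoment_map_plaqEquiv Ls μ ν (univ \ flatSheet Ls hij y), Finset.map_sdiff, Finset.map_univ_equiv,
    map_plaqEquiv_flatSheet Ls μ ν hij h' hT y]

/-- **The census polynomial of a plane is transported**: `N_{i'j'}(Ls ∘ τ) = N_{ij}(Ls)` with `(i', j')` the re-sorted pair
`(τ i, τ j)` — the object of every law of C-1 for the plane `(i, j)` of `Ls` IS the one for the plane `(i', j')` of `Ls ∘ τ`.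
[cite: Tomboulis2007Confinement, §4 (text before eq. (4.3))] -/
theorem twistCensusPoly_rectVortexSheet_transpose [∀ i, NeZero (Ls i)] {i j : Fin d} (hij : i < j) {i' j' : Fin d}
    (h' : i' < j') (hT : dirTranspose μ ν ⟨(i, j), hij⟩ = ⟨(i', j'), h'⟩) :
    twistCensusPoly (sides Ls μ ν) (rectVortexSheet (sides Ls μ ν) i' j' h') = twistCensusPoly Ls (rectVortexSheet Ls i j hij) := by
  rw [← map_plaqEquiv_rectVortexSheet Ls μ ν hij h' hT, twistCensusPoly_map_plaqEquiv]

/-- `|𝒱_{i'j'}(Ls ∘ τ)| = |𝒱_{ij}(Ls)|`. -/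
theorem card_rectVortexSheet_transpose [∀ i, NeZero (Ls i)] {i j : Fin d} (hij : i < j) {i' j' : Fin d}
    (h' : i' < j') (hT : dirTranspose μ ν ⟨(i, j), hij⟩ = ⟨(i', j'), h'⟩) :
    (rectVortexSheet (sides Ls μ ν) i' j' h').card = (rectVortexSheet Ls i j hij).card := by
  rw [← map_plaqEquiv_rectVortexSheet Ls μ ν hij h' hT, Finset.card_map]

end RectTranspose

end Summit.Ventures.YMGap.Census

end
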